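import Mathlib

/-!
# SoloBlind — a Goursat lemma for Lie subalgebras of a product with a simple factor

Solo-blind residency on `HodgeConjecture` (session 27).  This file kernel-checks "Lemma G" of the
residency's companion note (`paper/k3-weil-faces.md` §3.12(3)), the Lie-algebra step of
Proposition M (independence of the monodromy of two quaternionic Pryms of one genus-3 curve):

*Let `A`, `B` be Lie algebras over a commutative ring `K`, `A` simple, and `g ⊆ A × B` a Lie
subalgebra whose first projection is onto.  If `g` contains a non-zero element of the form
`(a, 0)`, then `g ⊇ A × 0`.*

Proof: `I := {a | (a, 0) ∈ g}` is an ideal of `A` — for `a ∈ I` and `x ∈ A` choose `(x, b) ∈ g`,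
then `⁅(x, b), (a, 0)⁆ = (⁅x, a⁆, 0) ∈ g` — and it is non-zero, hence everything.

In Proposition M it is applied with `A = B = 𝔰𝔬₈` (the connected monodromy algebras of the two
Pryms) and `(a, 0) = (n_c, 0)`, the logarithm of a lifted Dehn twist that moves one Prym and fixes
the other; the conclusion `g ⊇ 𝔰𝔬₈ × 0` (then `g = 𝔰𝔬₈ × 𝔰𝔬₈` since the second projection is onto
as well) separates the pair from the 28-dimensional "triality graph" of the Kuga–Satake twins.
We also record the consequence used there: under the hypotheses, membership in `g` only depends
on the second coordinate (`mem_iff_of_fst_surjective`), and if moreover the second projection is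
onto then `g = ⊤`.

No project imports; standard axioms only.
-/

namespace Summit.HodgeConjecture.HodgeConjecture.Theorems
namespace SoloBlindLieGoursat

variable {K : Type*} [CommRing K]
variable {A B : Type*} [LieRing A] [LieAlgebra K A] [LieRing B] [LieAlgebra K B]

/-- The first-factor kernel `{a | (a, 0) ∈ g}` of a Lie subalgebra `g ⊆ A × B` whose first
projection is onto, as a Lie ideal of `A`. -/
def fstKernel (g : LieSubalgebra K (A × B)) (hg : ∀ a : A, ∃ b : B, ((a, b) : A × B) ∈ g) :
    LieIdeal K A where
  carrier := {a : A | ((a, 0) : A × B) ∈ g}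
  zero_mem' := by
    change ((0, 0) : A × B) ∈ g
    exact g.zero_mem
  add_mem' := by
    intro a a' ha ha'
    change ((a + a', 0) : A × B) ∈ g
    have h := g.add_mem ha ha'
    simpa using h
  smul_mem' := by
    intro c a ha
    change ((c • a, 0) : A × B) ∈ g
    have h := g.smul_mem c ha
    simpa using h
  lie_mem := by
    intro x a ha
    change ((⁅x, a⁆, 0) : A × B) ∈ g
    obtain ⟨b, hb⟩ := hg x
    have h := g.lie_mem hb ha
    simpa [LieAlgebra.Prod.bracket_apply] using h

/-- Membership in `fstKernel g hg` unfolds to `(a, 0) ∈ g`. -/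
@[simp] theorem mem_fstKernel (g : LieSubalgebra K (A × B))
    (hg : ∀ a : A, ∃ b : B, ((a, b) : A × B) ∈ g) (a : A) :
    a ∈ fstKernel g hg ↔ ((a, 0) : A × B) ∈ g := Iff.rfl

/-- **Lemma G (Lie Goursat).**  If `A` is simple, `g ⊆ A × B` projects onto `A` and contains a
non-zero element `(a, 0)`, then `g ⊇ A × 0`. -/
theorem inl_mem_of_isSimple [LieAlgebra.IsSimple K A] (g : LieSubalgebra K (A × B))
    (hg : ∀ a : A, ∃ b : B, ((a, b) : A × B) ∈ g)
    (hx : ∃ a : A, a ≠ 0 ∧ ((a, 0) : A × B) ∈ g) :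
    ∀ a : A, ((a, 0) : A × B) ∈ g := by
  obtain ⟨a₀, ha₀, ha₀g⟩ := hx
  have hI : fstKernel g hg ≠ ⊥ := by
    intro h
    have : a₀ ∈ fstKernel g hg := ha₀g
    rw [h, LieSubmodule.mem_bot] at this
    exact ha₀ this
  rcases LieAlgebra.IsSimple.eq_bot_or_eq_top (fstKernel g hg) with h | h
  · exact absurd h hI
  · intro a
    have : a ∈ fstKernel g hg := by rw [h]; exact LieSubmodule.mem_top a
    exact this

/-- Under the hypotheses of `inl_mem_of_isSimple`, membership in `g` only depends on the second
coordinate: `(a, b) ∈ g ↔ (a', b) ∈ g`. -/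
theorem mem_iff_of_fst_surjective [LieAlgebra.IsSimple K A] (g : LieSubalgebra K (A × B))
    (hg : ∀ a : A, ∃ b : B, ((a, b) : A × B) ∈ g)
    (hx : ∃ a : A, a ≠ 0 ∧ ((a, 0) : A × B) ∈ g) (a a' : A) (b : B) :
    ((a, b) : A × B) ∈ g ↔ ((a', b) : A × B) ∈ g := by
  have key : ∀ a a' : A, ((a, b) : A × B) ∈ g → ((a', b) : A × B) ∈ g := by
    intro a a' h
    have h' := g.add_mem h (inl_mem_of_isSimple g hg hx (a' - a))
    simpa using h'
  exact ⟨key a a', key a' a⟩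

/-- **Corollary.**  If in addition the second projection of `g` is onto, then `g` is everything:
the pair of monodromy algebras is independent. -/
theorem eq_top_of_isSimple [LieAlgebra.IsSimple K A] (g : LieSubalgebra K (A × B))
    (hgA : ∀ a : A, ∃ b : B, ((a, b) : A × B) ∈ g)
    (hgB : ∀ b : B, ∃ a : A, ((a, b) : A × B) ∈ g)
    (hx : ∃ a : A, a ≠ 0 ∧ ((a, 0) : A × B) ∈ g) :
    g = ⊤ := by
  ext ⟨a, b⟩
  refine ⟨fun _ => trivial, fun _ => ?_⟩
  obtain ⟨a', ha'⟩ := hgB b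
  exact (mem_iff_of_fst_surjective g hgA hx a a' b).mpr ha'

end SoloBlindLieGoursat
end Summit.HodgeConjecture.HodgeConjecture.Theorems
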